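import Summits.HodgeConjecture.HodgeConjecture.Theorems.Ring2HypothesesDescent
import Summits.HodgeConjecture.HodgeConjecture.Theorems.Ring2LitMotivatedClassesOfStandardB
import HarnessLib

/-!
# Ring 2 — hypotheses layer, part XXXV: the André §2.1 BINDER LEDGER of the descent axis — the standard-conjecture rows of part III binder-free in `hBA` (and in `hΔ`)

HONEST FRAMING (page 1, unchanged): research route conditional on HC_CM; not a corollary; Q11.4-sentence-2
already refuted in dim ≥ 3.

Cell `pub-hodge-ring2`, seat `pub-hodge-ring2-typer2`, gen 32. `HC_CM` is the named statement
`Theses.RankFourFaces.CMAbelianHodge` (stmt-HodgeConjecture-3052); on this axis it is never an input — it occurs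
below only as a CONCLUSION (row 5), through the landed `Ring2.Deform.HC_CM_of_HC_AV`. Nothing here proves a case
of the Hodge conjecture: every row is an implication between NAMED typed statements of the tree, and Grothendieck's
standard conjecture `B` (Kleiman's polarised form `StandardConjectureBStar`, for EVERY smooth projective complex
variety) stays a displayed binder `hB` of every row that had it. Sorry-free; axioms `propext`, `Classical.choice`,
`Quot.sound`.

## Why this file exists (count once)

Part III (`Ring2HypothesesDescent`, gen 2) typed the motivated-classes column of the descent diagram with TWO print
inputs as binders: André 1996 Thm. 0.6.2 (`hAM : Andre1996_hodgeClasses_abelianVariety_motivated`, Hodge classes on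
abelian varieties are motivated) and André 1996 §2.1, remark following Déf. 1 (`hBA :
Andre1996_motivatedClasses_le_algebraicClasses_of_standardConjectureB`: `B` for all smooth projective complex
varieties ⟹ `A_mot(X) ⊆ A(X)`). The second is now a THEOREM of the tree WITHOUT HYPOTHESES:
`Theorems.Andre1996_motivatedClasses_le_algebraicClasses_of_standardConjectureB_holds`
(`Theorems/Ring2LitMotivatedClassesOfStandardB`, found and written by the cell's literature seat, gen 24: the
Literature assembly `…_holds_of` — André's remark reduces to the multiplicativity of algebraic classes — applied to
`Theorems.Voisin2003_cupProduct_algebraicClasses_holds`, itself the diagonal pull-back of the exterior product by the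
PROVED pull-back theorem `Theorems.fulton1998_map_mem_algebraicClasses_holds` of route `BoundaryReadout`,
2026-08-17). The same pull-back theorem discharges the one extra input `hΔ` (diagonal pull-back preserves algebraic
classes) of part III's second, fact-free derivation through route `MotivatedLefschetzSplit`. Landed signatures are
never edited in place, so — exactly as in parts XXV (André §2.5 c)), XXX-C, XXXII and XXXIII — each row gets an
ADDITIVE twin `<name>_discharged` with the SAME statement minus the discharged binder; part III's theorems stay
(each is implied by its twin). The mathematics discharged here is the two routes' and the literature seat's; this
file only re-bases the hypotheses axis' own rows BY NAME.

## Ledger (the 3 rows of part III carrying `hBA` or `hΔ` ↦ binder-free twins; `B(all)` := `∀ d Z η,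
IsSmoothProjective d Z → StandardConjectureBStar d Z η`; `HC_AV` = `Theses.PadicSemiregularLift.HodgeAbelianVarieties`)

| # | twin (this file) | of (part III row) | binders left |
|---|---|---|---|
| 1 | `motivatedImpliesAlgebraic_of_standardConjectureB_discharged` | `motivatedImpliesAlgebraic_of_standardConjectureB (hB) (hBA)` | `B(all)` |
| 2 | `motivatedImpliesAlgebraic_of_lefschetzStandardB_discharged` | `motivatedImpliesAlgebraic_of_lefschetzStandardB_of_diagonalPullback (hB) (hΔ)` | `B(all)` |
| 3 | `motivatedImpliesAlgebraicAV_of_standardConjectureB_discharged` | row 1 ∘ `motivatedImpliesAlgebraicAV_of_all` | `B(all)` |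
| 4 | `hc_av_of_standardConjectureB_of_andre_discharged` | `hc_av_of_standardConjectureB_of_andre (hB) (hBA) (hAM)` | `B(all)`, `hAM` |
| 5 | `hc_cm_of_standardConjectureB_of_andre_discharged` (HC_CM as CONCLUSION) | row 4 ∘ `Ring2.Deform.HC_CM_of_HC_AV` | `B(all)`, `hAM` |

plus the input of row 2 as a stand-alone theorem, `diagonalPullback_mem_algebraicClasses_holds`. After this file the
LIVE `hBA` binders of the hypotheses axis are 0 of 2 and the only print binder left on the standard-conjecture rows
of the descent axis is `hAM` (André Thm. 0.6.2; refereed, a hypothesis in Lean — no tree proof, none claimed).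
HONEST COLUMN: rows 1–3 say `B(all) ⟹ A_mot = A` (on all varieties / on abelian varieties) with no named fact at
all — two derivations, through André's remark and through route `MotivatedLefschetzSplit`; rows 4–5 say
`B(all) ∧ [André 0.6.2] ⟹ HC_AV ⟹ HC_CM`. `B(all)` is Grothendieck's OPEN standard conjecture; none of this is
evidence for it, and the converse direction `HC_AV ⟹ MotivatedImpliesAlgebraicAV` (part XXV, fact-free) does not
touch `B`. WHAT THE KERNEL ROWS ADD about Hodge classes: NOTHING new — a STATUS WORD of the hypotheses census moves:
André §2.1 NAMED-FACT (binder) → TREE-THEOREM (by name).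

References (bib keys): Andre1996Motifs (§2.1 remark following Déf. 1, p. 14; Thm. 0.4; Thm. 0.6.2, p. 9; §6.3);
VoisinHodgeII2003 (Prop. 9.20, Prop. 9.21 (i)); Fulton1998 (Cor. 19.2 (b)); Grothendieck1968 (§3, p. 196, `B(X)`);
Kleiman1968 (§2, 2A11).
-/

noncomputable section

set_option linter.dupNamespace false

open CategoryTheory
open Literature.AlgebraicGeometry Literature.AlgebraicGeometry.Motives
open Literature.AlgebraicGeometry.HodgeTheory

namespace Summit.HodgeConjecture.HodgeConjecture.Ring2.Hypotheses

/-! ### §1 `B(all) ⟹ A_mot = A`, binder-free in André §2.1 -/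

/-- **Row 1 — `B(all) ⟹ MotivatedImpliesAlgebraic`, André's §2.1 remark now a tree theorem**: part III's
`motivatedImpliesAlgebraic_of_standardConjectureB` with `hBA` fed by
`Theorems.Andre1996_motivatedClasses_le_algebraicClasses_of_standardConjectureB_holds`.
[cite: Andre1996Motifs, §2.1 remark following Déf. 1 (p. 14)] [cite: Grothendieck1968, §3 p. 196 (B(X))] -/
theorem motivatedImpliesAlgebraic_of_standardConjectureB_discharged
    (hB : ∀ (d : ℕ) (Z : SchemeOver ℂ) (η : complexBetti Z 2), IsSmoothProjective d Z →
      StandardConjectureBStar d Z η) :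
    MotivatedImpliesAlgebraic :=
  motivatedImpliesAlgebraic_of_standardConjectureB hB
    Theorems.Andre1996_motivatedClasses_le_algebraicClasses_of_standardConjectureB_holds

/-- **Diagonal pull-back preserves algebraic classes** — the input `hΔ` of part III's second derivation, BY NAME from
route `BoundaryReadout`'s proved pull-back theorem `Theorems.fulton1998_map_mem_algebraicClasses_holds` (Fulton
Cor. 19.2 (b) / Voisin II Prop. 9.21 (i) on the tree's carriers) at the diagonal `V ⟶ V ⊗ V`, `V ⊗ V` smooth
projective by `IsSmoothProjective.tensor_holds`. [cite: Fulton1998, Cor. 19.2 (b)] [cite: VoisinHodgeII2003, Prop. 9.21 (i)] -/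
theorem diagonalPullback_mem_algebraicClasses_holds ⦃d : ℕ⦄ ⦃V : SchemeOver ℂ⦄ (hV : IsSmoothProjective d V)
    (p : ℕ) ⦃c : complexBetti (MonoidalCategory.tensorObj V V) (2 * p)⦄
    (hc : c ∈ algebraicClasses (MonoidalCategory.tensorObj V V) p) :
    complexBetti.map (CartesianMonoidalCategory.lift (𝟙 V) (𝟙 V)) (2 * p) c ∈ algebraicClasses V p :=
  Theorems.fulton1998_map_mem_algebraicClasses_holds (CartesianMonoidalCategory.lift (𝟙 V) (𝟙 V))
    (IsSmoothProjective.tensor_holds hV hV) hV p _ hc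

/-- **Row 2 — `B(all) ⟹ MotivatedImpliesAlgebraic` with NO named fact at all**: part III's
`motivatedImpliesAlgebraic_of_lefschetzStandardB_of_diagonalPullback` (route `MotivatedLefschetzSplit`, item
stmt-HodgeConjecture-17934, proved) with `hΔ` fed by `diagonalPullback_mem_algebraicClasses_holds`. A second, independent
in-tree derivation of row 1. [cite: Andre1996Motifs, §2.1 remark following Déf. 1 (p. 14)]
[cite: VoisinHodgeII2003, Prop. 9.20–9.21] -/
theorem motivatedImpliesAlgebraic_of_lefschetzStandardB_discharged
    (hB : ∀ (d : ℕ) (Z : SchemeOver ℂ) (η : complexBetti Z 2), IsSmoothProjective d Z →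
      StandardConjectureBStar d Z η) :
    MotivatedImpliesAlgebraic :=
  motivatedImpliesAlgebraic_of_lefschetzStandardB_of_diagonalPullback hB diagonalPullback_mem_algebraicClasses_holds

/-- **Row 3 — `B(all) ⟹ MotivatedImpliesAlgebraicAV`** (the cell brief's `Motivated_implies_Alg ⟨abelian varieties⟩`
under `B(all)`), by restriction. [cite: Andre1996Motifs, §2.1 and Thm. 0.6.2 (p. 9)] -/
theorem motivatedImpliesAlgebraicAV_of_standardConjectureB_discharged
    (hB : ∀ (d : ℕ) (Z : SchemeOver ℂ) (η : complexBetti Z 2), IsSmoothProjective d Z →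
      StandardConjectureBStar d Z η) :
    MotivatedImpliesAlgebraicAV :=
  motivatedImpliesAlgebraicAV_of_all (motivatedImpliesAlgebraic_of_standardConjectureB_discharged hB)

/-! ### §2 The standard-conjecture chain to `HC_AV`, one print binder left -/

/-- **Row 4 — `B(all) ∧ [André 0.6.2] ⟹ HC_AV`, NO `HC_CM`, NO André-§2.1 binder**: part III's
`hc_av_of_standardConjectureB_of_andre` with `hBA` discharged; the only named fact left is André's Thm. 0.6.2
(Hodge classes on complex abelian varieties are motivated; refereed, a hypothesis in Lean).
[cite: Andre1996Motifs, Thm. 0.6.2 (p. 9) and §2.1] [cite: Grothendieck1968, §3 p. 196 (B(X))] -/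
theorem hc_av_of_standardConjectureB_of_andre_discharged
    (hB : ∀ (d : ℕ) (Z : SchemeOver ℂ) (η : complexBetti Z 2), IsSmoothProjective d Z →
      StandardConjectureBStar d Z η)
    (hAM : Andre1996_hodgeClasses_abelianVariety_motivated) :
    Theses.PadicSemiregularLift.HodgeAbelianVarieties :=
  hc_av_of_standardConjectureB_of_andre hB
    Theorems.Andre1996_motivatedClasses_le_algebraicClasses_of_standardConjectureB_holds hAM

/-- **Row 5 — … ⟹ HC_CM** (a CONSEQUENCE on this axis, through the landed `Ring2.Deform.HC_CM_of_HC_AV`; `HC_CM` is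
not an input anywhere in this file). [cite: Andre1996Motifs, Thm. 0.6.2 (p. 9) and §2.1] -/
theorem hc_cm_of_standardConjectureB_of_andre_discharged
    (hB : ∀ (d : ℕ) (Z : SchemeOver ℂ) (η : complexBetti Z 2), IsSmoothProjective d Z →
      StandardConjectureBStar d Z η)
    (hAM : Andre1996_hodgeClasses_abelianVariety_motivated) :
    Theses.RankFourFaces.CMAbelianHodge :=
  Ring2.Deform.HC_CM_of_HC_AV (hc_av_of_standardConjectureB_of_andre_discharged hB hAM)

/-! ### §3 The ledger as one conjunction -/

/-- **André-§2.1 binder ledger of the descent axis** (one conjunction a referee can quote): the former print binder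
`hBA` is a tree theorem; the diagonal pull-back input `hΔ` is a tree theorem; and under `B(all)` alone the two
"motivated ⟹ algebraic" statements hold, and with André's Thm. 0.6.2 so do `HC_AV` and (as a consequence) `HC_CM`.
[cite: Andre1996Motifs, §2.1 remark following Déf. 1 (p. 14), Thm. 0.6.2 (p. 9)] [cite: VoisinHodgeII2003, Prop. 9.20, 9.21 (i)]
[cite: Fulton1998, Cor. 19.2 (b)] [cite: Grothendieck1968, §3 p. 196 (B(X))] -/
theorem andre21_binder_ledger :
    Andre1996_motivatedClasses_le_algebraicClasses_of_standardConjectureB ∧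
      (∀ ⦃d : ℕ⦄ ⦃V : SchemeOver ℂ⦄, IsSmoothProjective d V → ∀ (p : ℕ)
        ⦃c : complexBetti (MonoidalCategory.tensorObj V V) (2 * p)⦄,
        c ∈ algebraicClasses (MonoidalCategory.tensorObj V V) p →
          complexBetti.map (CartesianMonoidalCategory.lift (𝟙 V) (𝟙 V)) (2 * p) c ∈ algebraicClasses V p) ∧
      ((∀ (d : ℕ) (Z : SchemeOver ℂ) (η : complexBetti Z 2), IsSmoothProjective d Z →
          StandardConjectureBStar d Z η) →
        MotivatedImpliesAlgebraic ∧ MotivatedImpliesAlgebraicAV ∧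
          (Andre1996_hodgeClasses_abelianVariety_motivated →
            Theses.PadicSemiregularLift.HodgeAbelianVarieties ∧ Theses.RankFourFaces.CMAbelianHodge)) :=
  ⟨Theorems.Andre1996_motivatedClasses_le_algebraicClasses_of_standardConjectureB_holds,
    diagonalPullback_mem_algebraicClasses_holds,
    fun hB ↦ ⟨motivatedImpliesAlgebraic_of_lefschetzStandardB_discharged hB,
      motivatedImpliesAlgebraicAV_of_standardConjectureB_discharged hB,
      fun hAM ↦ ⟨hc_av_of_standardConjectureB_of_andre_discharged hB hAM,
        hc_cm_of_standardConjectureB_of_andre_discharged hB hAM⟩⟩⟩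

end Summit.HodgeConjecture.HodgeConjecture.Ring2.Hypotheses

end
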